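import Mathlib
import Summits.Ventures.PercRepro2.Defs
import Summits.Ventures.PercRepro2.Graph
import Summits.Ventures.PercRepro2.OneColourSwitch
import Summits.Ventures.PercRepro2.RegionHubSign
import Summits.Ventures.PercRepro2.SideSwitch
import Summits.Ventures.PercRepro2.SideSwitchFibre
import Summits.Ventures.PercRepro2.SideSwitchClosed
import Summits.Ventures.PercRepro2.SideSwitchComps
import Summits.Ventures.PercRepro2.SideSwitchCompsFibre
import Summits.Ventures.PercRepro2.M9NoPocketDefs
import Summits.Ventures.PercRepro2.M9NoPocketWorld
import Summits.Ventures.PercRepro2.M9NoPocketWorldD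
import Summits.Ventures.PercRepro2.M9NoPocketFibre
import Summits.Ventures.PercRepro2.M9SubcubeHarris
import Summits.Ventures.PercRepro2.M9ClusterFibreHarris
import Summits.Ventures.PercRepro2.M9ClusterAvoidHarris
import Summits.Ventures.PercRepro2.M9PocketUnitFibre
import Summits.Ventures.PercRepro2.M9PocketUnitFibreSum
import Summits.Ventures.PercRepro2.M9PocketPsi2
import Summits.Ventures.PercRepro2.M9PocketPsi2Sign
import Summits.Ventures.PercRepro2.M9PocketPsi2Mono

/-!
# The legality of the flipped point is monotone along the exploration fibre, part 2 (blind
cell PercRepro2, p3 g39, 2026-08-29; `proofs/P3-POCKETRK.md` §5″ Step 2–3 and §9 K5/K6)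

Continuation of `M9PocketPsi2Mono`: the `Y`-link `r ~_Y s` passes from `Ψ ω₁` to `Ψ ω₂`
(`conn_rs_psi2_of_le`: a `Y`-path from `r` at `Ψ ω₁` runs through `C ∪ {r, s}`, `d` and pocket
vertices — never through the `W`-side, by `DOne` — its edges inside `C ∪ {r, s, d}` are fixed
and its pocket detours are shortcut at `d`), «no `W`-link», `Sep` and `DOne` pass
(`not_conn_compl_rs_psi2_of_le`, `sep2_psi2_of_le`, `DOne_psi2_of_le`: the `Y`-worlds shrink
with `Ψ ω₂ ≤ Ψ ω₁`, the `W`-clusters of `r, s` shrink by `cluster_compl_psi2_subset_of_le`),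
and the whole legality of an `EX` point with `σ_rs = 1` passes: **`legal_psi2_of_le`** — the
unpaired set of `proofs/P3-POCKETRK.md` §5″ is a lower set on every exploration fibre.  Own
work; std axioms.
-/

namespace Summit.Ventures.PercRepro2

namespace NoPocket

open Finset Classical OneColourSwitch SideSwitch

variable {V : Type*} {E : Type*} {ends : E → Sym2 V} {p q r s d : V} {ρ : Config E}
  {C : Set V}

section Fibre

variable (hdr : d ≠ r) (hds : d ≠ s) (hrs : within ends ({r, s} : Set V) = ∅)
  (hT : ∀ e, ends e ≠ s(d, r) ∧ ends e ≠ s(d, s))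
  (hsep : sep2 ends p q r s ρ) (hD : DOne ends r s d ρ)
  (hB : ∀ x ∈ M2 (endsD ends d) r s ρ, x = r ∨ x = s)
  (hC : C ⊆ K2 (endsD ends d) r s ρ) (hCr : r ∉ C) (hCs : s ∉ C)
  (hcl : ClosedIn (endsD ends d) (sided (endsD ends d) r s ρ) C)
  {ω₁ ω₂ : Config E}
  (h₁ : ∀ e ∈ touches ends (cluster ends ρ d ∪ K2 (endsD ends d) r s ρ ∪
    M2 (endsD ends d) r s ρ), ω₁ e = ρ e)
  (h₂ : ∀ e ∈ touches ends (cluster ends ρ d ∪ K2 (endsD ends d) r s ρ ∪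
    M2 (endsD ends d) r s ρ), ω₂ e = ρ e)
  (hle : ω₁ ≤ ω₂)

include hdr hds hrs hT hsep hB hC hcl h₁ h₂ in
/-- **The `Y`-link passes from `Ψ ω₁` to `Ψ ω₂`**: a `Y`-path from `r` at `Ψ ω₁` runs through
`C ∪ {r, s}`, `d` and pocket vertices (never through the `W`-side, by `DOne`); its edges
inside `C ∪ {r, s, d}` are fixed and its pocket detours are shortcut at `d`. -/
lemma conn_rs_psi2_of_le
    (hK₁' : K2 (endsD ends d) r s (fun e => if e ∈ touches ends C then ω₁ e else !ω₁ e) =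
      M2 (endsD ends d) r s ρ ∪ C)
    (hM₁' : M2 (endsD ends d) r s (fun e => if e ∈ touches ends C then ω₁ e else !ω₁ e) =
      K2 (endsD ends d) r s ρ \ C)
    (hD₁ : DOne ends r s d (fun e => if e ∈ touches ends C then ω₁ e else !ω₁ e))
    (h : Conn ends (fun e => if e ∈ touches ends C then ω₁ e else !ω₁ e) r s) :
    Conn ends (fun e => if e ∈ touches ends C then ω₂ e else !ω₂ e) r s := by
  set ω₁' := (fun e => if e ∈ touches ends C then ω₁ e else !ω₁ e) with hω₁'
  set ω₂' := (fun e => if e ∈ touches ends C then ω₂ e else !ω₂ e) with hω₂'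
  have hsepD := sep2_endsD_of_sep2 (d := d) hsep
  -- a fixed edge has the same colour at `Ψ ω₁` and `Ψ ω₂`
  have hfix : ∀ e ∈ touches ends (cluster ends ρ d ∪ K2 (endsD ends d) r s ρ ∪
      M2 (endsD ends d) r s ρ), ω₂' e = ω₁' e := by
    intro e he
    simp only [hω₁', hω₂', h₁ e he, h₂ e he]
  have key : s ∈ {x | Conn ends ω₁' r x ∧
      ¬ (x ∈ K2 (endsD ends d) r s ρ ∧ x ∉ C ∧ x ≠ r ∧ x ≠ s) ∧
      ((x ∈ C ∨ x = r ∨ x = s) → Conn ends ω₂' r x) ∧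
      ((x ∉ C ∧ x ≠ r ∧ x ≠ s) → Conn ends ω₂' r d)} := by
    refine mem_of_conn_of_closed ?_ ⟨conn_refl _ _ _, fun h' => h'.2.2.1 rfl,
      fun _ => conn_refl _ _ _, fun h' => (h'.2.1 rfl).elim⟩ h
    rintro x ⟨hrx, hxW, hxA, hxO⟩ y hxy
    obtain ⟨_, e, he, hends⟩ := openGraph_adj.1 hxy
    have hry : Conn ends ω₁' r y := conn_trans hrx (conn_of_openAdj ⟨e, he, hends⟩)
    -- `y` is never a `W`-side vertex of `Ψ ω₁`
    have hyW : ¬ (y ∈ K2 (endsD ends d) r s ρ ∧ y ∉ C ∧ y ≠ r ∧ y ≠ s) := by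
      rintro ⟨hyK, hyC, hyr, hys⟩
      have hyM : y ∈ M2 ends r s ω₁' :=
        M2_endsD_subset_M2 _ (by rw [hM₁']; exact ⟨hyK, hyC⟩)
      have hyd : y ≠ d := by rintro rfl; exact not_mem_K2_endsD hdr hds ρ hyK
      exact hD₁ y hyr hys hyd (mem_K2_iff.2 (Or.inl hry)) hyM
    refine ⟨hry, hyW, ?_, ?_⟩
    · -- `y ∈ C ∪ {r, s}`: the edge is fixed (it touches `C`), or impossible
      intro hyA
      by_cases hxA' : x ∈ C ∨ x = r ∨ x = s
      · have hrx' := hxA hxA'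
        have htC : e ∈ touches ends C := by
          rcases hxA' with hx | hx | hx
          · exact mem_touches_of_ends hends (Or.inl hx)
          · rcases hyA with hy | hy | hy
            · exact mem_touches_of_ends hends (Or.inr hy)
            · exfalso
              have : e ∈ within ends ({r, s} : Set V) := ⟨x, by simp [hx], y, by simp [hy], hends⟩
              rw [hrs] at this; exact this
            · exfalso
              have : e ∈ within ends ({r, s} : Set V) := ⟨x, by simp [hx], y, by simp [hy], hends⟩
              rw [hrs] at this; exact this
          · rcases hyA with hy | hy | hy
            · exact mem_touches_of_ends hends (Or.inr hy)
            · exfalso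
              have : e ∈ within ends ({r, s} : Set V) := ⟨x, by simp [hx], y, by simp [hy], hends⟩
              rw [hrs] at this; exact this
            · exfalso
              have : e ∈ within ends ({r, s} : Set V) := ⟨x, by simp [hx], y, by simp [hy], hends⟩
              rw [hrs] at this; exact this
        have hU : e ∈ touches ends (cluster ends ρ d ∪ K2 (endsD ends d) r s ρ ∪
            M2 (endsD ends d) r s ρ) := by
          obtain ⟨z, hz, w, hzw⟩ := htC
          exact ⟨z, Or.inl (Or.inr (hC hz)), w, hzw⟩
        refine conn_trans hrx' (conn_of_openAdj ⟨e, ?_, hends⟩)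
        rw [hfix e hU]; exact he
      · have hxO' := hxO ⟨fun h' => hxA' (Or.inl h'), fun h' => hxA' (Or.inr (Or.inl h')),
          fun h' => hxA' (Or.inr (Or.inr h'))⟩
        by_cases hxd : x = d
        · -- from `d` into `C`: the edge is fixed
          subst x
          rcases hyA with hy | hy | hy
          · have htC : e ∈ touches ends C := mem_touches_of_ends hends (Or.inr hy)
            have hU : e ∈ touches ends (cluster ends ρ d ∪ K2 (endsD ends d) r s ρ ∪
                M2 (endsD ends d) r s ρ) :=
              ⟨d, Or.inl (Or.inl (mem_cluster_self ends ρ d)), y, hends⟩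
            refine conn_trans hxO' (conn_of_openAdj ⟨e, ?_, hends⟩)
            rw [hfix e hU]; exact he
          · exact ((hT e).1 (by rw [hends, hy])).elim
          · exact ((hT e).2 (by rw [hends, hy])).elim
        · -- from a pocket vertex into `C ∪ {r, s}`: impossible
          exfalso
          have hxK : x ∉ K2 (endsD ends d) r s ρ := fun h' =>
            hxW ⟨h', fun h'' => hxA' (Or.inl h''), fun h'' => hxA' (Or.inr (Or.inl h'')),
              fun h'' => hxA' (Or.inr (Or.inr h''))⟩
          have hxM : x ∉ M2 (endsD ends d) r s ρ := by
            intro h'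
            rcases hB x h' with h'' | h''
            · exact hxA' (Or.inr (Or.inl h''))
            · exact hxA' (Or.inr (Or.inr h''))
          rcases hyA with hy | hy | hy
          · -- an edge from outside `K₂(G − d)` into `C`: `W` at `ρ`, fixed, unchanged
            have hyK : y ∈ K2 (endsD ends d) r s ρ := hC hy
            have hyd : y ≠ d := by rintro rfl; exact not_mem_K2_endsD hdr hds ρ hyK
            have hde : d ∉ ends e := notMem_of_ends_ne hends hxd hyd
            have hρe : ρ e = false := by
              cases h' : ρ e
              · rfl
              · exact (hxK (mem_K2_of_open hyK h' (by
                  rw [endsD_of_notMem hde, hends, Sym2.eq_swap]))).elim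
            have hU : e ∈ touches ends (cluster ends ρ d ∪ K2 (endsD ends d) r s ρ ∪
                M2 (endsD ends d) r s ρ) := mem_touches_of_ends hends (Or.inr (Or.inl (Or.inr hyK)))
            have htC : e ∈ touches ends C := mem_touches_of_ends hends (Or.inr hy)
            simp only [hω₁', psi2_of_mem htC, h₁ e hU, hρe] at he
            exact absurd he (by decide)
          · have hyd : y ≠ d := by rw [hy]; exact hdr.symm
            have hde : d ∉ ends e := notMem_of_ends_ne hends hxd hyd
            rcases mem_U2_endsD_of_edge_rs hsepD hde (by rw [hends, Sym2.eq_swap]) (Or.inl hy)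
              with h' | h'
            · exact hxK h'
            · exact hxM h'
          · have hyd : y ≠ d := by rw [hy]; exact hds.symm
            have hde : d ∉ ends e := notMem_of_ends_ne hends hxd hyd
            rcases mem_U2_endsD_of_edge_rs hsepD hde (by rw [hends, Sym2.eq_swap]) (Or.inr hy)
              with h' | h'
            · exact hxK h'
            · exact hxM h'
    · -- `y ∉ C ∪ {r, s}`: `d` is reached at `Ψ ω₂`
      rintro ⟨hyC, hyr, hys⟩
      by_cases hxA' : x ∈ C ∨ x = r ∨ x = s
      · have hrx' := hxA hxA'
        by_cases hyd : y = d
        · subst y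
          rcases hxA' with hx | hx | hx
          · have htC : e ∈ touches ends C := mem_touches_of_ends hends (Or.inl hx)
            have hU : e ∈ touches ends (cluster ends ρ d ∪ K2 (endsD ends d) r s ρ ∪
                M2 (endsD ends d) r s ρ) :=
              ⟨d, Or.inl (Or.inl (mem_cluster_self ends ρ d)), x, by rw [hends, Sym2.eq_swap]⟩
            refine conn_trans hrx' (conn_of_openAdj ⟨e, ?_, hends⟩)
            rw [hfix e hU]; exact he
          · exact ((hT e).1 (by rw [hends, hx, Sym2.eq_swap])).elim
          · exact ((hT e).2 (by rw [hends, hx, Sym2.eq_swap])).elim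
        · -- `y` would be outside `K₂(G − d)` and adjacent to `C ∪ {r, s}` by a `Y` edge
          exfalso
          have hyK : y ∉ K2 (endsD ends d) r s ρ := fun h' => hyW ⟨h', hyC, hyr, hys⟩
          rcases hxA' with hx | hx | hx
          · have hxK : x ∈ K2 (endsD ends d) r s ρ := hC hx
            have hxd : x ≠ d := by rintro rfl; exact not_mem_K2_endsD hdr hds ρ hxK
            have hde : d ∉ ends e := notMem_of_ends_ne hends hxd hyd
            have htC : e ∈ touches ends C := mem_touches_of_ends hends (Or.inl hx)
            have hU : e ∈ touches ends (cluster ends ρ d ∪ K2 (endsD ends d) r s ρ ∪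
                M2 (endsD ends d) r s ρ) := mem_touches_of_ends hends (Or.inl (Or.inl (Or.inr hxK)))
            simp only [hω₁', psi2_of_mem htC, h₁ e hU] at he
            exact hyK (mem_K2_of_open hxK he (by rw [endsD_of_notMem hde, hends]))
          · have hyM : y ∉ M2 (endsD ends d) r s ρ := by
              intro h'
              rcases hB y h' with h'' | h''
              · exact hyr h''
              · exact hys h''
            rcases mem_U2_endsD_of_edge_rs hsepD (notMem_of_ends_ne hends (hx ▸ hdr.symm) hyd)
              (by rw [hends, hx]) (Or.inl rfl) with h' | h'
            · exact hyK h'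
            · exact hyM h'
          · have hyM : y ∉ M2 (endsD ends d) r s ρ := by
              intro h'
              rcases hB y h' with h'' | h''
              · exact hyr h''
              · exact hys h''
            rcases mem_U2_endsD_of_edge_rs hsepD (notMem_of_ends_ne hends (hx ▸ hds.symm) hyd)
              (by rw [hends, hx]) (Or.inr rfl) with h' | h'
            · exact hyK h'
            · exact hyM h'
      · exact hxO ⟨fun h' => hxA' (Or.inl h'), fun h' => hxA' (Or.inr (Or.inl h')),
          fun h' => hxA' (Or.inr (Or.inr h'))⟩
  exact key.2.2.1 (Or.inr (Or.inr rfl))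

omit hsep hD hcl hle in
include hdr hds hB hC hCr hCs h₁ h₂ in
/-- «No `W`-link» passes from `Ψ ω₁` to `Ψ ω₂`. -/
lemma not_conn_compl_rs_psi2_of_le
    (hK₁' : K2 (endsD ends d) r s (fun e => if e ∈ touches ends C then ω₁ e else !ω₁ e) =
      M2 (endsD ends d) r s ρ ∪ C)
    (hD₁ : DOne ends r s d (fun e => if e ∈ touches ends C then ω₁ e else !ω₁ e))
    (h : ¬ Conn ends (OneColourSwitch.compl
      (fun e => if e ∈ touches ends C then ω₁ e else !ω₁ e)) r s) :
    ¬ Conn ends (OneColourSwitch.compl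
      (fun e => if e ∈ touches ends C then ω₂ e else !ω₂ e)) r s :=
  fun h' => h (cluster_compl_psi2_subset_of_le hdr hds hB hC hCr hCs h₁ h₂ hK₁' hD₁ (Or.inl rfl) h')

omit hsep hD hcl in
include hdr hds hB hC hCr hCs h₁ h₂ hle in
/-- `Sep` passes from `Ψ ω₁` to `Ψ ω₂`. -/
lemma sep2_psi2_of_le
    (hK₁' : K2 (endsD ends d) r s (fun e => if e ∈ touches ends C then ω₁ e else !ω₁ e) =
      M2 (endsD ends d) r s ρ ∪ C)
    (hD₁ : DOne ends r s d (fun e => if e ∈ touches ends C then ω₁ e else !ω₁ e))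
    (hsep₁ : sep2 ends p q r s (fun e => if e ∈ touches ends C then ω₁ e else !ω₁ e)) :
    sep2 ends p q r s (fun e => if e ∈ touches ends C then ω₂ e else !ω₂ e) := by
  have hle' := psi2_le_psi2_of_le hC h₁ h₂ hle
  have hK : ∀ x, x ∈ K2 ends r s (fun e => if e ∈ touches ends C then ω₂ e else !ω₂ e) →
      x ∈ K2 ends r s (fun e => if e ∈ touches ends C then ω₁ e else !ω₁ e) := by
    intro x hx
    rcases mem_K2_iff.1 hx with hc | hc
    · exact mem_K2_iff.2 (Or.inl (conn_mono hle' hc))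
    · exact mem_K2_iff.2 (Or.inr (conn_mono hle' hc))
  have hM : ∀ x, x ∈ M2 ends r s (fun e => if e ∈ touches ends C then ω₂ e else !ω₂ e) →
      x ∈ M2 ends r s (fun e => if e ∈ touches ends C then ω₁ e else !ω₁ e) := by
    intro x hx
    rcases mem_M2_iff.1 hx with hc | hc
    · exact mem_M2_iff.2 (Or.inl
        (cluster_compl_psi2_subset_of_le hdr hds hB hC hCr hCs h₁ h₂ hK₁' hD₁ (Or.inl rfl) hc))
    · exact mem_M2_iff.2 (Or.inr
        (cluster_compl_psi2_subset_of_le hdr hds hB hC hCr hCs h₁ h₂ hK₁' hD₁ (Or.inr rfl) hc))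
  obtain ⟨⟨hpK, hqK⟩, ⟨hpM, hqM⟩⟩ := sep2_iff.1 hsep₁
  exact sep2_iff.2 ⟨⟨fun h => hpK (hK p h), fun h => hqK (hK q h)⟩,
    ⟨fun h => hpM (hM p h), fun h => hqM (hM q h)⟩⟩

omit hsep hD hcl in
include hdr hds hB hC hCr hCs h₁ h₂ hle in
/-- `DOne` passes from `Ψ ω₁` to `Ψ ω₂`. -/
lemma DOne_psi2_of_le
    (hK₁' : K2 (endsD ends d) r s (fun e => if e ∈ touches ends C then ω₁ e else !ω₁ e) =
      M2 (endsD ends d) r s ρ ∪ C)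
    (hD₁ : DOne ends r s d (fun e => if e ∈ touches ends C then ω₁ e else !ω₁ e)) :
    DOne ends r s d (fun e => if e ∈ touches ends C then ω₂ e else !ω₂ e) := by
  have hle' := psi2_le_psi2_of_le hC h₁ h₂ hle
  intro x hxr hxs hxd hxK hxM
  have hxK' : x ∈ K2 ends r s (fun e => if e ∈ touches ends C then ω₁ e else !ω₁ e) := by
    rcases mem_K2_iff.1 hxK with hc | hc
    · exact mem_K2_iff.2 (Or.inl (conn_mono hle' hc))
    · exact mem_K2_iff.2 (Or.inr (conn_mono hle' hc))
  have hxM' : x ∈ M2 ends r s (fun e => if e ∈ touches ends C then ω₁ e else !ω₁ e) := by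
    rcases mem_M2_iff.1 hxM with hc | hc
    · exact mem_M2_iff.2 (Or.inl
        (cluster_compl_psi2_subset_of_le hdr hds hB hC hCr hCs h₁ h₂ hK₁' hD₁ (Or.inl rfl) hc))
    · exact mem_M2_iff.2 (Or.inr
        (cluster_compl_psi2_subset_of_le hdr hds hB hC hCr hCs h₁ h₂ hK₁' hD₁ (Or.inr rfl) hc))
  exact hD₁ x hxr hxs hxd hxK' hxM'

omit hD in
include hdr hds hrs hT hsep hB hC hCr hCs hcl h₁ h₂ hle in
/-- **The legality of the flipped point is monotone along the fibre**: if `Ψ ω₁` is `Sep`,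
`DOne`, doubly reached at `d` and `Y`-linked without a `W`-link, so is `Ψ ω₂`. -/
theorem legal_psi2_of_le
    (hL : sep2 ends p q r s (fun e => if e ∈ touches ends C then ω₁ e else !ω₁ e) ∧
      DOne ends r s d (fun e => if e ∈ touches ends C then ω₁ e else !ω₁ e) ∧
      d ∈ K2 ends r s (fun e => if e ∈ touches ends C then ω₁ e else !ω₁ e) ∧
      d ∈ M2 ends r s (fun e => if e ∈ touches ends C then ω₁ e else !ω₁ e) ∧
      Conn ends (fun e => if e ∈ touches ends C then ω₁ e else !ω₁ e) r s ∧
      ¬ Conn ends (OneColourSwitch.compl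
        (fun e => if e ∈ touches ends C then ω₁ e else !ω₁ e)) r s) :
    sep2 ends p q r s (fun e => if e ∈ touches ends C then ω₂ e else !ω₂ e) ∧
      DOne ends r s d (fun e => if e ∈ touches ends C then ω₂ e else !ω₂ e) ∧
      d ∈ K2 ends r s (fun e => if e ∈ touches ends C then ω₂ e else !ω₂ e) ∧
      d ∈ M2 ends r s (fun e => if e ∈ touches ends C then ω₂ e else !ω₂ e) ∧
      Conn ends (fun e => if e ∈ touches ends C then ω₂ e else !ω₂ e) r s ∧
      ¬ Conn ends (OneColourSwitch.compl
        (fun e => if e ∈ touches ends C then ω₂ e else !ω₂ e)) r s := by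
  obtain ⟨hsep₁, hD₁, hK₁, hM₁, hY₁, hW₁⟩ := hL
  have hK₁' := K2_endsD_psi2_fibre hdr hds hrs hT hsep hB hC hCr hCs hcl h₁
  have hK₂' := K2_endsD_psi2_fibre hdr hds hrs hT hsep hB hC hCr hCs hcl h₂
  have hM₁' := M2_endsD_psi2_fibre hdr hds hrs hT hsep hB hC hCr hCs hcl h₁
  have hM₂' := M2_endsD_psi2_fibre hdr hds hrs hT hsep hB hC hCr hCs hcl h₂
  exact ⟨sep2_psi2_of_le hdr hds hB hC hCr hCs h₁ h₂ hle hK₁' hD₁ hsep₁,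
    DOne_psi2_of_le hdr hds hB hC hCr hCs h₁ h₂ hle hK₁' hD₁,
    d_mem_K2_psi2_of_le hdr hds hT h₁ h₂ hK₁' hK₂' hB hK₁,
    d_mem_M2_psi2_of_le hdr hds h₁ h₂ hM₁' hM₂' hM₁,
    conn_rs_psi2_of_le hdr hds hrs hT hsep hB hC hcl h₁ h₂ hK₁' hM₁' hD₁ hY₁,
    not_conn_compl_rs_psi2_of_le hdr hds hB hC hCr hCs h₁ h₂ hK₁' hD₁ hW₁⟩

end Fibre

end NoPocket

end Summit.Ventures.PercRepro2
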